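import Literature.AlgebraicGeometry.Frobenioids.ArchimedeanA0Monomorphisms
import HarnessLib

/-!
# Frobenioids II, Proposition 3.4 (viii) at the level of `F₀`: the case `F₀ = A₀` of the
# FSMI-factorisation (abc-iut cell, layer L1, node `FrdII:Prop3.4(viii)/P34-L12`, chain LC-L1-2)

Mochizuki, *The geometry of Frobenioids II: poly-Frobenioids*, Kyushu J. Math. **62** (2008)
401–460, §3, Proposition 3.4 (viii), proof, journal p. 427 ll. 6–46 (= kurims p. 32)
[cite: MochizukiFrdII2008, Prop 3.4 (viii) p.32]:

> "I claim that `F₀` is of FSMFF-type. Indeed, let `φ : A → B` be an FSM-morphism of `F₀` … Now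
> suppose that `A`, `B` are complex. … Thus, we conclude that `φ` factors as a composite of finitely
> many FSMI-morphisms."

PROOF-ONLY file (nothing defined), part 3b of sub-DAG row `P34-L12` (`F0FSMFactorsFSMI`): the
angular Frobenioid `A₀` (Example 3.3 (iii)). `A0.exists_isFSMIChain_of_isFSM`: every FSM-morphism
`φ` of `A₀` between COMPLEX objects that is not an isomorphism is a finite composite of
FSMI-morphisms — by strong induction on `deg_Fr(φ)`: for `deg_Fr = 1` the dense-image dichotomy of
part 1 makes `φ` a slit morphism, irreducible (`A0.isFSMI_of_isFSM_of_degFr_eq_one`); otherwise split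
off the smallest prime `p` (`A0.exists_pow_factor`, part 3a): `φ = β ≫ ψ` with `β : X → X^{(p)}` an
FSMI-morphism (fiberwise surjective and mono formally from `φ` once `ψ` is mono — Remark 3.3.1 both
ways and `A^{⊗p} = {a^p}` —, irreducible by `A0.isIrreducible_powArrow`) and `ψ` an FSM-morphism of
smaller degree. Real objects are excluded (complex regime, RULING R37; the typed (viii) is refuted
at `π = 𝟭 D₀` by a complex→real arrow, `ArchimedeanFSMFFCounterexample.lean`). No side is taken on
[IUTchIII] Cor. 3.12.
-/

namespace Literature.AlgebraicGeometry.Frobenioids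

open CategoryTheory Set
open scoped Pointwise

noncomputable section

namespace ArchFrd

namespace A0

/-- Fiberwise surjectivity of `φ` in `A₀` supplies the squares over sub-region inclusions that the
`C₀`-level dense-image argument consumes. [cite: MochizukiFrdII2008, Prop 3.4 (viii) p.32] -/
theorem fill_of_isFiberwiseSurjective {X Y : A0} (φ : X ⟶ Y) (hφ : IsFiberwiseSurjective φ) :
    ∀ (W : C0) (g : W ⟶ Y.obj), C0.degFr g = 1 → C0.scalar g = 1 →
      PreFrobenioid.IsIsometry C0.toElem g →
        ∃ (V : C0) (δX : V ⟶ X.obj) (δW : V ⟶ W), δX ≫ φ.hom = δW ≫ g := by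
  intro W g _ _ hgiso
  let W' : A0 := ⟨W⟩
  let γ : W' ⟶ Y := ⟨g, hgiso⟩
  obtain ⟨V', δX', δW', hsq⟩ := hφ γ
  exact ⟨V'.obj, δX'.hom, δW'.hom, congrArg InducedWideCategory.Hom.hom hsq⟩

/-- **The linear case in `A₀`**: an FSM-morphism of `A₀` of Frobenius degree `1` between complex
objects that is not an isomorphism is an FSMI-morphism (a slit morphism).
[cite: MochizukiFrdII2008, Prop 3.4 (viii) p.32] -/
theorem isFSMI_of_isFSM_of_degFr_eq_one {X Y : A0} (hY : Y.obj.IsComplexObj) (φ : X ⟶ Y)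
    (hφ : IsFSM φ) (hφ' : ¬ IsIso φ) (hlin : C0.degFr φ.hom = 1) : IsFSMI φ := by
  refine ⟨hφ, hφ', fun M β α hfac => ?_⟩
  have hXc : X.obj.IsComplexObj := isComplexObj_of_hom φ hY
  have hMc : M.obj.IsComplexObj := isComplexObj_of_hom α hY
  have hfacC : β.hom ≫ α.hom = φ.hom := congrArg InducedWideCategory.Hom.hom hfac
  obtain ⟨hlinβ, hlinα⟩ := C0.degFr_eq_one_of_comp β.hom α.hom (hfacC.symm ▸ hlin)
  obtain ⟨A', hA'c, hA't, hA'd, -⟩ := exists_pulledRegion Y.obj (C0.Base φ.hom)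
  rcases C0.smul_dir_pow_eq_or_slit_of_fill hY φ.hom hA'c hA'd
      (fill_of_isFiberwiseSurjective φ hφ.1) with hfull | ⟨-, -, z₀, hz₀⟩
  · exfalso
    apply hφ'
    haveI : IsIso (C0.Base φ.hom) := D0.isIso_of_isComplex _ hXc hY
    rw [hlin, PNat.one_coe, pow_one] at hfull
    haveI : IsIso φ.hom :=
      C0.isIso_of_isometry_of_dir φ.hom ⟨hlin, (C0.isBaseIso_iff _).mpr inferInstance⟩ φ.property
        hA'c hA't hfull.symm.subset
    exact isIso_of_isIso_hom φ
  · rw [hlin, PNat.one_coe, pow_one] at hz₀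
    have hX : X.obj.region.dir = {(unitPart ℂ (C0.scalar φ.hom))⁻¹ • z₀}ᶜ := by
      have := congrArg (fun T => (unitPart ℂ (C0.scalar φ.hom))⁻¹ • T) hz₀
      simp only [inv_smul_smul] at this
      rw [this, Set.smul_set_compl, Set.smul_set_singleton]
    obtain ⟨A'', hA''c, hA''t, hA''d, -⟩ := exists_pulledRegion M.obj (C0.Base β.hom)
    have hβdir := (C0.hom_conditions β.hom hA''c).1
    rw [hlinβ, PNat.one_coe, pow_one, hX, Set.smul_set_compl, Set.smul_set_singleton] at hβdir
    haveI : IsIso (C0.Base β.hom) := D0.isIso_of_isComplex _ hXc hMc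
    haveI : IsIso (C0.Base α.hom) := D0.isIso_of_isComplex _ hMc hY
    rcases NormOne.eq_univ_or_eq_compl_of_compl_subset hβdir with hMu | hMs
    · left
      have hMiso : M.obj.region.dir = univ :=
        C0.eq_univ_of_twist_image_eq_univ (C0.Base β.hom) (hA''d ▸ hMu)
      obtain ⟨A₃, hA₃c, hA₃t, -, -⟩ := exists_pulledRegion Y.obj (C0.Base α.hom)
      haveI : IsIso α.hom :=
        C0.isIso_of_isometry_of_dir α.hom ⟨hlinα, (C0.isBaseIso_iff _).mpr inferInstance⟩ α.property
          hA₃c hA₃t (by rw [hMiso, Set.smul_set_univ]; exact subset_univ _)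
      exact isIso_of_isIso_hom α
    · right
      haveI : IsIso β.hom :=
        C0.isIso_of_isometry_of_dir β.hom ⟨hlinβ, (C0.isBaseIso_iff _).mpr inferInstance⟩ β.property
          hA''c hA''t (by rw [hMs, hX, Set.smul_set_compl, Set.smul_set_singleton])
      exact isIso_of_isIso_hom β

/-- The induction on the Frobenius degree behind `A0.exists_isFSMIChain_of_isFSM`.
[cite: MochizukiFrdII2008, Prop 3.4 (viii) p.32] -/
theorem exists_isFSMIChain_of_isFSM_aux (d : ℕ) :
    ∀ {X Y : A0}, Y.obj.IsComplexObj → ∀ φ : X ⟶ Y, (C0.degFr φ.hom : ℕ) = d → IsFSM φ →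
      ¬ IsIso φ → ∃ n, IsFSMIChain φ n := by
  induction d using Nat.strong_induction_on with
  | _ d ih =>
  intro X Y hY φ hd hφ hφ'
  have hX : X.obj.IsComplexObj := isComplexObj_of_hom φ hY
  by_cases hd1 : d = 1
  · subst hd1
    exact ⟨1, IsFSMIChain.single φ
      (isFSMI_of_isFSM_of_degFr_eq_one hY φ hφ hφ' (PNat.coe_inj.mp hd))⟩
  -- `d ≥ 2`: split off the smallest prime factor
  have hd0 : d ≠ 0 := by rw [← hd]; exact (C0.degFr φ.hom).ne_zero
  have hp : d.minFac.Prime := Nat.minFac_prime hd1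
  obtain ⟨m, hm⟩ : d.minFac ∣ d := Nat.minFac_dvd d
  have hmpos : 0 < m := Nat.pos_of_ne_zero fun h0 => hd0 (by rw [hm, h0, mul_zero])
  let p' : ℕ+ := ⟨d.minFac, hp.pos⟩
  let m' : ℕ+ := ⟨m, hmpos⟩
  have hpm : p' * m' = C0.degFr φ.hom := PNat.coe_inj.mp (by rw [PNat.mul_coe, hd, hm]; rfl)
  obtain ⟨P, β, ψ, hfac, hP, hPd, hPc, hβd, hβs, hβt, hψd, -, -⟩ := exists_pow_factor hX φ p' m' hpm
  haveI : Mono φ := hφ.2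
  -- injectivity of the power maps on `B_X` and on `A_X`, `A_X^{⊗p}`
  have hinjd : Set.InjOn (fun z : ↥(normOneSubgroup ℂ) => z ^ d) X.obj.region.dir := by
    rw [← hd]; exact injOn_pow_dir_of_mono hX φ
  have hinjp : Set.InjOn (fun z : ↥(normOneSubgroup ℂ) => z ^ d.minFac) X.obj.region.dir := by
    intro z₁ hz₁ z₂ hz₂ heq
    refine hinjd hz₁ hz₂ ?_
    change z₁ ^ d = z₂ ^ d
    have heq' : z₁ ^ d.minFac = z₂ ^ d.minFac := heq
    rw [hm, pow_mul, pow_mul, heq']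
  have hinjψ : Set.InjOn (fun u : ℂˣ => u ^ (C0.degFr ψ.hom : ℕ)) P.obj.region.carrier := by
    rw [hψd, hPc]
    change Set.InjOn (fun u : ℂˣ => u ^ m) (X.obj.region.carrier ^ (d.minFac : ℕ))
    obtain ⟨n, hn⟩ : ∃ n, d.minFac = n + 1 := ⟨_, (Nat.succ_pred_eq_of_pos hp.pos).symm⟩
    rw [hn, AngularRegion.carrier_pow_eq_image, ← hn]
    rintro _ ⟨x₁, hx₁, rfl⟩ _ ⟨x₂, hx₂, rfl⟩ heq
    have heq' : x₁ ^ d = x₂ ^ d := by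
      have := heq
      simp only [← pow_mul] at this
      change x₁ ^ ((p' : ℕ) * m) = x₂ ^ ((p' : ℕ) * m) at this
      rwa [show (p' : ℕ) * m = d from hm.symm] at this
    change x₁ ^ (p' : ℕ) = x₂ ^ (p' : ℕ)
    rw [X.obj.region.injOn_pow_carrier_of_dir hd0 hinjd hx₁ hx₂ heq']
  -- `ψ` is an FSM-morphism, `β` is an FSMI-morphism
  haveI hψm : Mono ψ := mono_of_injOn_pow_carrier hP hY ψ hinjψ
  have hφfs : IsFiberwiseSurjective (β ≫ ψ) := hfac ▸ hφ.1
  have hψfsm : IsFSM ψ := ⟨IsFiberwiseSurjective.of_comp β ψ hφfs, hψm⟩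
  haveI : Mono (β ≫ ψ) := hfac ▸ hφ.2
  have hβfsm : IsFSM β := ⟨IsFiberwiseSurjective.of_comp_mono β ψ hφfs, mono_of_mono β ψ⟩
  have hβirr : IsIrreducibleHom β :=
    isIrreducible_powArrow hX hP β hp (by rw [hβd]; rfl) hβs hβt hPd hinjp
  have hβ : IsFSMI β := ⟨hβfsm, hβirr⟩
  by_cases hψiso : IsIso ψ
  · refine ⟨1, ?_⟩
    rw [← hfac]
    exact IsFSMIChain.single _ ⟨hfac ▸ hφ, IsIrreducibleHom.comp_isIso hβirr ψ⟩
  · have hmd : m < d := by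
      rw [hm]
      exact lt_mul_left hmpos hp.one_lt
    obtain ⟨k, hk⟩ := ih m hmd hY ψ (by rw [hψd]; rfl) hψfsm hψiso
    exact ⟨k + 1, hfac ▸ IsFSMIChain.cons β ψ k hβ hk⟩

/-- **[FrdII] Prop. 3.4 (viii) for `F₀ = A₀`, condition (a) of FSMFF-type between complex objects**:
every FSM-morphism `φ` of the angular Frobenioid `A₀` between complex objects that is not an
isomorphism is a finite composite of FSMI-morphisms — the prime factorisation of `deg_Fr(φ)` into
`p`-th power arrows `X → X^{(p)}` ("`β = β_b ∘ ⋯ ∘ β₁` prime-Frobenius, co-angular, monomorphisms,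
bijective on angular regions, hence FSMI"), followed, if `φ` is not of Frobenius type, by a slit
morphism. [cite: MochizukiFrdII2008, Prop 3.4 (viii) p.32] -/
theorem exists_isFSMIChain_of_isFSM {X Y : A0} (hY : Y.obj.IsComplexObj) (φ : X ⟶ Y)
    (hφ : IsFSM φ) (hφ' : ¬ IsIso φ) : ∃ n, IsFSMIChain φ n :=
  exists_isFSMIChain_of_isFSM_aux _ hY φ rfl hφ hφ'

end A0

end ArchFrd

end

end Literature.AlgebraicGeometry.Frobenioids
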